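import Summits.CriticalPhenomena.Ising3DConformalLimit.Theorems.HyperoctahedralRPExistsScaleCovariantLimitDecimationTwoCouplingGKS
import Summits.CriticalPhenomena.Ising3DConformalLimit.Theorems.HyperoctahedralRPExistsScaleCovariantLimitDecimationBoxBridge
import Summits.CriticalPhenomena.Ising3DConformalLimit.Theorems.HyperoctahedralRPExistsScaleCovariantLimitDecimationCurveEndpoints
import HarnessLib

/-!
# The susceptibility-critical curve `J_χ(K)` of the two-coupling ferromagnet: an antitone graph in `[0, β_c]²`

Crux `ExistsScaleCovariantLimit` (stmt-CriticalPhenomena-1981), line `decimation-homotopy-rate` (lead c8), scaffolding of the research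
stubs `PathLipschitz 2/3` (support target (s3) of the line card, its provable part): the critical curve
`Jcrit p K = inf {J ≥ 0 : x ↦ ⟨σ₀σ_{px}⟩_{K,J} not summable}` along which `PathLipschitz p` is stated is a well-defined ANTITONE
graph over the n.n. coupling `K ≥ 0`, with values in `[0, β_c(3)]`, joining `(0, β_c)` to `(β_c, 0)` (endpoints: stub C, p129855).
Ingredients: Griffiths' comparison for the sublattice pair function in both couplings (`TwoCouplingGKS.subPair_mono`, p130454), the
`K = 0` identification `subPair p 0 J = twoPointFree 3 J` and sharpness `Summable (twoPointFree 3 J) ↔ J < β_c` (stub C helpers over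
stubs E p130071, B p129928).

* `not_summable_subPair_of_criticalBeta_le` — `χ_sub(K, J) = ∞` for `K ≥ 0`, `J ≥ β_c`;
* `Jcrit_nonneg`, `Jcrit_le_criticalBeta` — `0 ≤ J_χ(K) ≤ β_c` for `K ≥ 0`;
* `Jcrit_antitoneOn` (registered sub-goal) — `K ↦ J_χ(K)` is antitone on `[0, ∞)`.

Sources: S. Friedli, Y. Velenik, *Statistical Mechanics of Lattice Systems* (CUP 2017), Exercise 3.31 (Griffiths' comparison),
§3.7.4 (susceptibility); M. Aizenman, D. Barsky, R. Fernández, J. Stat. Phys. 47 (1987) (sharpness, `χ < ∞ ⟺ β < β_c`).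
-/

noncomputable section

open Filter Topology
open scoped BigOperators
open Literature.Probability.LatticeModels
open Classical

namespace Summit.CriticalPhenomena.Ising3DConformalLimit.Cruxes.ExistsScaleCovariantLimit.DecimationHomotopyRate

/-- **`χ_sub(K, J) = ∞` above the n.n. critical coupling**: for `K ≥ 0` and `J ≥ β_c(3)` the sublattice pair function of the
period-`p` (`p ≥ 2`) two-coupling model is not summable — Griffiths' comparison with the `K = 0`, `J = β_c` model, which is the
critical n.n. model on `pℤ³` (stubs E, B, C). [cite: FriedliVelenik2017, Exercise 3.31, p. 142] -/
theorem not_summable_subPair_of_criticalBeta_le {p : ℕ} (hp : 2 ≤ p) {K J : ℝ} (hK : 0 ≤ K)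
    (hJ : criticalBeta 3 ≤ J) : ¬ Summable (subPair p K J) := by
  have hβ : 0 ≤ criticalBeta 3 := criticalBeta_nonneg 3
  intro hs
  -- compare with `(K, J) = (0, β_c)`
  have hle : ∀ x, subPair p 0 (criticalBeta 3) x ≤ subPair p K J x := fun x =>
    TwoCouplingGKS.subPair_mono p le_rfl hK hβ hJ x
  have hs0 : Summable (subPair p 0 (criticalBeta 3)) :=
    hs.of_nonneg_of_le (fun x => TwoCouplingGKS.subPair_nonneg p le_rfl hβ x) hle
  rw [curveEndpoints_subPair_zero_K stub_endpointIdentity stub_boxBridge hp hβ] at hs0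
  exact (lt_irrefl _) ((curveEndpoints_summable_twoPointFree_iff hβ).1 hs0)

/-- `β_c(3)` lies in the defining set of `J_χ(K)` for every `K ≥ 0`. [cite: FriedliVelenik2017, §3.7.4] -/
theorem criticalBeta_mem_JcritSet {p : ℕ} (hp : 2 ≤ p) {K : ℝ} (hK : 0 ≤ K) :
    criticalBeta 3 ∈ {J : ℝ | 0 ≤ J ∧ ¬ Summable (subPair p K J)} :=
  ⟨criticalBeta_nonneg 3, not_summable_subPair_of_criticalBeta_le hp hK le_rfl⟩

/-- `0 ≤ J_χ(K)` (the defining set lies in `[0, ∞)`; `sInf ∅ = 0`). [folklore] -/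
theorem Jcrit_nonneg (p : ℕ) (K : ℝ) : 0 ≤ Jcrit p K :=
  Real.sInf_nonneg fun _ hJ => hJ.1

/-- **`J_χ(K) ≤ β_c(3)` for `K ≥ 0`.** [cite: FriedliVelenik2017, §3.7.4] -/
theorem Jcrit_le_criticalBeta {p : ℕ} (hp : 2 ≤ p) {K : ℝ} (hK : 0 ≤ K) : Jcrit p K ≤ criticalBeta 3 :=
  csInf_le ⟨0, fun _ hJ => hJ.1⟩ (criticalBeta_mem_JcritSet hp hK)

/-- **The critical curve is antitone** (registered sub-goal): for the period-`p` two-coupling family, `p ≥ 2`, `K ↦ J_χ(K)` is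
nonincreasing on `[0, ∞)` — raising the n.n. coupling raises the sublattice pair function (Griffiths' comparison), so the
non-summability set of `J`'s grows. [cite: FriedliVelenik2017, Exercise 3.31, p. 142] -/
theorem Jcrit_antitoneOn : ∀ p : ℕ, 2 ≤ p → AntitoneOn (Jcrit p) (Set.Ici 0) := by
  intro p hp K hK K' _ hKK'
  have hK0 : 0 ≤ K := hK
  -- `{J ≥ 0 | χ_sub(K,J) = ∞} ⊆ {J ≥ 0 | χ_sub(K',J) = ∞}`
  have hsub : {J : ℝ | 0 ≤ J ∧ ¬ Summable (subPair p K J)} ⊆ {J : ℝ | 0 ≤ J ∧ ¬ Summable (subPair p K' J)} := by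
    rintro J ⟨hJ0, hns⟩
    refine ⟨hJ0, fun hs => hns ?_⟩
    exact hs.of_nonneg_of_le (fun x => TwoCouplingGKS.subPair_nonneg p hK0 hJ0 x)
      fun x => TwoCouplingGKS.subPair_mono p hK0 hKK' hJ0 le_rfl x
  exact csInf_le_csInf ⟨0, fun _ hJ => hJ.1⟩ ⟨_, criticalBeta_mem_JcritSet hp hK0⟩ hsub

/-- The curve stays in the square `[0, β_c]²` over `[0, β_c]`: `J_χ(K) ∈ [0, β_c]` for `K ∈ [0, β_c]`, with the endpoint values
`J_χ(0) = β_c`, `J_χ(β_c) = 0` (stub C). [cite: FriedliVelenik2017, §3.7.4] -/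
theorem Jcrit_mem_Icc {p : ℕ} (hp : 2 ≤ p) {K : ℝ} (hK : K ∈ Set.Icc (0 : ℝ) (criticalBeta 3)) :
    Jcrit p K ∈ Set.Icc (0 : ℝ) (criticalBeta 3) :=
  ⟨Jcrit_nonneg p K, Jcrit_le_criticalBeta hp hK.1⟩

end Summit.CriticalPhenomena.Ising3DConformalLimit.Cruxes.ExistsScaleCovariantLimit.DecimationHomotopyRate

end
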